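import Mathlib
import Summits.QuantumFields.YangMills.Theses.VortexVolumeRatchet
import Summits.QuantumFields.YangMills.Theses.FluxSectorAlternative

/-!
# Assembly of LINE g20-B `VortexVolumeRatchet` (seat ym-idea-4) and the cross-edge to g20-A

* `assembly_proof : VortexVolumeRatchet.Assembly` — the route's Assembly item (case split on the flux alternative; the
  heavy branch is contradicted by the volume ratchet through `not_tendsto_zero_of_ratchet`: a positive sequence that
  is eventually non-decreasing along the dyadic sides `2^{n+1}` cannot tend to `0` along all sides).
* `noHiggsMode_of_ratchet : VortexVolumeRatchet.DyadicVolumeRatchet → FluxSectorAlternative.NoHiggsMode` — the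
  cross-edge: the new crux is the rigid form of g20-A's node ⟨stmt-QuantumFields-23870⟩.
No summit and no crux is proved here. [folklore]
-/

namespace Summit.QuantumFields.YangMills.Theorems.VortexVolumeRatchet

open Filter Topology

/-- Arithmetic: `M + 2 ≤ 2 ^ (n₀ + M + 1)`. -/
theorem add_two_le_two_pow (n₀ M : ℕ) : M + 2 ≤ 2 ^ (n₀ + M + 1) := by
  have h1 : M < 2 ^ M := Nat.lt_two_pow_self
  have h2 : 2 ^ M ≤ 2 ^ (n₀ + M) := Nat.pow_le_pow_right (by norm_num) (by omega)
  have h3 : 2 ^ (n₀ + M + 1) = 2 * 2 ^ (n₀ + M) := by ring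
  omega

/-- The heavy ('t Hooft–Higgs) branch is incompatible with the volume ratchet: a ratio that is eventually
non-decreasing along the dyadic sides and positive cannot tend to `0` along all sides. -/
theorem not_tendsto_zero_of_ratchet {N : ℕ}
    (r : Literature.MathematicalPhysics.QuantumFieldTheory.LatticeRep (Matrix.specialUnitaryGroup (Fin N) ℂ))
    (β : ℝ) (z : Matrix.specialUnitaryGroup (Fin N) ℂ) (q : {p : Fin 4 × Fin 4 // p.1 < p.2})
    (hrat : ∃ n₀ : ℕ, ∀ n : ℕ, n₀ ≤ n →
      Literature.MathematicalPhysics.QuantumFieldTheory.twistedPartitionFunction r.ρ β (2 ^ (n + 1) - 2 + 2) z q /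
        Literature.MathematicalPhysics.QuantumFieldTheory.twistedPartitionFunction r.ρ β (2 ^ (n + 1) - 2 + 2) 1 q ≤
      Literature.MathematicalPhysics.QuantumFieldTheory.twistedPartitionFunction r.ρ β (2 ^ (n + 2) - 2 + 2) z q /
        Literature.MathematicalPhysics.QuantumFieldTheory.twistedPartitionFunction r.ρ β (2 ^ (n + 2) - 2 + 2) 1 q) :
    ¬ Tendsto (fun n : ℕ =>
        Literature.MathematicalPhysics.QuantumFieldTheory.twistedPartitionFunction r.ρ β (n + 2) z q /
          Literature.MathematicalPhysics.QuantumFieldTheory.twistedPartitionFunction r.ρ β (n + 2) 1 q) atTop (𝓝 0) := by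
  -- abbreviate the ratio along the sides `m + 2`
  set R : ℕ → ℝ := fun n : ℕ =>
    Literature.MathematicalPhysics.QuantumFieldTheory.twistedPartitionFunction r.ρ β (n + 2) z q /
      Literature.MathematicalPhysics.QuantumFieldTheory.twistedPartitionFunction r.ρ β (n + 2) 1 q with hR
  intro hzero
  obtain ⟨n₀, hn₀⟩ := hrat
  -- the ratchet as a statement about `R`
  have hstep : ∀ n : ℕ, n₀ ≤ n → R (2 ^ (n + 1) - 2) ≤ R (2 ^ (n + 2) - 2) := fun n hn => hn₀ n hn
  -- induction: the ratio at side 2^(n₀+k+1) dominates the ratio at side 2^(n₀+1)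
  have hmono : ∀ k : ℕ, R (2 ^ (n₀ + 1) - 2) ≤ R (2 ^ (n₀ + k + 1) - 2) := by
    intro k
    induction k with
    | zero => simp
    | succ k ih =>
      have h := hstep (n₀ + k) (Nat.le_add_right _ _)
      have e : n₀ + (k + 1) + 1 = n₀ + k + 2 := by ring
      rw [e]
      exact ih.trans h
  -- positivity of the ratio at the base side
  have hpos : 0 < R (2 ^ (n₀ + 1) - 2) := by
    simp only [hR]
    exact div_pos
      (Literature.MathematicalPhysics.QuantumFieldTheory.twistedPartitionFunction_pos r.ρ r.continuous β z q)
      (Literature.MathematicalPhysics.QuantumFieldTheory.twistedPartitionFunction_pos r.ρ r.continuous β 1 q)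
  -- the full sequence is eventually below the base value
  have hev : ∀ᶠ m in atTop, R m < R (2 ^ (n₀ + 1) - 2) := (tendsto_order.1 hzero).2 _ hpos
  obtain ⟨M, hM⟩ := eventually_atTop.1 hev
  have hle : M ≤ 2 ^ (n₀ + M + 1) - 2 := by
    have := add_two_le_two_pow n₀ M
    omega
  exact absurd (hmono M) (not_le.2 (hM _ hle))

/-- The route's Assembly item ⟨stmt-QuantumFields-23466⟩: `GapForcesFluxAlternative → DyadicVolumeRatchet →
VortexAreaLawDeniesPerimeter → DeconfinedIsMassless` — case split on the flux alternative; the light branch (all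
`z, q`) goes to the Tomboulis–Yaffe support against the perimeter hypothesis, the heavy branch is contradicted by the
volume ratchet (`not_tendsto_zero_of_ratchet`). -/
theorem assembly_proof : Summit.QuantumFields.YangMills.Theses.VortexVolumeRatchet.Assembly := by
  intro hK1 hK2 hK3 N hN r
  obtain ⟨A, B, hAB⟩ := hK1 N hN r
  refine ⟨A, B, fun β hβ hper hclus => ?_⟩
  refine hK3 N hN r β hβ ?_ hper
  intro z hz hz1 q
  rcases hAB β hβ hclus z hz hz1 q with harea | hzero
  · exact harea
  · exact absurd hzero (not_tendsto_zero_of_ratchet r β z q (hK2 N hN r β hβ z hz hz1 q))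

/-- The new crux implies LINE g20-A's `NoHiggsMode` ⟨stmt-QuantumFields-23870⟩ letter for letter (cross-edge). -/
theorem noHiggsMode_of_ratchet (h : Summit.QuantumFields.YangMills.Theses.VortexVolumeRatchet.DyadicVolumeRatchet) :
    Summit.QuantumFields.YangMills.Theses.FluxSectorAlternative.NoHiggsMode :=
  fun N hN r β hβ z hz hz1 q => not_tendsto_zero_of_ratchet r β z q (h N hN r β hβ z hz hz1 q)


end Summit.QuantumFields.YangMills.Theorems.VortexVolumeRatchet
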